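import Summits.QuantumAdvantage.QuantumAdvantage.Theorems.CubicForrelationNearExactIsExactKtGapTwoSixteen

/-!
# Crux `CubicForrelation.NearExactIsExact` (stmt-QuantumAdvantage-14043) — the SECOND Kasami–Tokura gap of cubics for EVERY `m`: no Boolean
  function of degree `≤ 3` has weight strictly between `1.75·2^{m-3}` and `1.875·2^{m-3}`

Certificate seat `b2b-cforr-cert` (gen 18).  HONEST FRAMING: a coding-theory BRICK (standard axioms), uniform in `m` — NOT summit progress.  It upgrades
`kt_gap2_cubic_le_sixteen` (`…KtGapTwoSixteen.lean`) by a UNIFORM closing of `ktg2_step`'s system for `k ≥ 17` (`ktg2_no_solution_large`) plus the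
finite cases `k = 12 … 16`.  The uniform closing uses only Parseval, the count and `2^k ∣ t²`: with `L = 2^k`, Parseval gives `32t² ≤ 175L + 18t`
(`ktg2_t_sq_le`), so `t² ∈ {L, 2L, 4L}`, i.e. `t = T`, `L ∈ {T², T²/2, T²/4}` with `T` a power of two; Parseval + count then read
`B(T+2) + 3C(3T+2) = 143T + 18`, resp. `B(T+4) + 3C(3T+4) = 111T + 36`, resp. (with `t = 2T`, `L = T²`) `B(T+4) + 3C(3T+4) = 47T + 36`; reducing
modulo `T + 2` resp. `T + 4` (`C < 16, 13, 6`) gives `(T+2) ∣ 268 − 12C`, `(T+4) ∣ 408 − 24C`, `(T+4) ∣ 152 − 24C` with positive right-hand sides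
`≤ 268, 408, 152` — impossible for `T ≥ 512`, i.e. for every `k ≥ 17`.  (Kasami–Tokura 1970 obtain the gap for every `m` from their classification
of all words of `RM(r,m)` of weight `< 2d`; the proof here is self-contained and classification-free, the closure constraint `C + 1 = 2^j` of
`…KtGapTwoClosure.lean` being needed only at `m = 10, 11`.)  Statement: `kt_gap2_cubic` — for every `m` and every `c : 𝔽₂^m → 𝔽₂` of degree
`≤ 3`, NOT (`7·2^m < 32·#{c = 1}` and `64·#{c = 1} < 15·2^m`); `rm3_weights_below_fifteen_eighths_all` (cubic weights `< 1.875d` are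
`0, d, 1.5d, 1.75d`, every `m`).

References: T. Kasami, N. Tokura, IEEE Trans. IT 16 (1970) 752–759, Thm 1; MacWilliams–Sloane (1977) Ch. 15 §3.  Axioms: standard.
-/

set_option linter.dupNamespace false -- D-0017: single-problem summit ⇒ `QuantumAdvantage.QuantumAdvantage` by design

noncomputable section

namespace Summit.QuantumAdvantage.QuantumAdvantage.Theorems.CubicForrelation.NearExactIsExact

open Finset
open Literature.Computability.QuantumComplexity

/-! ### The finite cases `k = 12 … 16` -/

/-- `k = 12` (`m = 17`): `2^12 ∣ t²`, `2t < 2^12` and the Parseval bound leave `t ∈ {64, 128}`; `t = 64` dies by Parseval + count (`33B + 291C = 4585` has no solution); `t = 128` dies by Parseval + count (`17B + 147C = 761` has no solution). [this work] -/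
theorem ktg2_no_solution_twelve (w t A B C n₁ n₂ n₃ P : ℕ) (hw : w = 7 * 2 ^ 12 + t) (ht : 0 < t)
    (h2 : 2 * t < 2 ^ 12) (hdvd : 2 ^ 12 ∣ t * t) (hABC : A + B + C + 1 = 32 * 2 ^ 12)
    (hP : A * t ^ 2 + B * (2 ^ 12 + t) ^ 2 + C * (3 * 2 ^ 12 + t) ^ 2 + w ^ 2 = 32 * 2 ^ 12 * w)
    (hI : n₁ * (3 * 2 ^ 12 + t) + n₂ * (2 ^ 12 + t) + n₃ * t + w = w ^ 2)
    (h4 : w ^ 4 + A * t ^ 4 + B * (2 ^ 12 + t) ^ 4 + C * (3 * 2 ^ 12 + t) ^ 4 =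
      32 * 2 ^ 12 * (w ^ 2 + n₁ * (3 * 2 ^ 12 + t) ^ 2 + n₂ * (2 ^ 12 + t) ^ 2 + n₃ * t ^ 2))
    (hC : C + 1 = P) : False := by
  have htt := ktg2_t_sq_le 12 w t A B C hw hABC hP
  have hst : 2 ^ 6 ∣ t := by have := ktg_two_pow_dvd_of_sq (a := 12) (by simpa using hdvd); simpa using this
  obtain ⟨q, rfl⟩ : ∃ q, t = 64 * q := ⟨t / 64, by norm_num at hst; omega⟩
  have hq : q < 3 := by
    clear h4 hI hP hABC hdvd hC ht h2
    norm_num at htt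
    nlinarith [htt]
  interval_cases q
  · omega
  · subst hw; norm_num at hP hABC; clear h4 hI; omega
  · subst hw; norm_num at hP hABC; clear h4 hI; omega

/-- `k = 13` (`m = 18`): `2^13 ∣ t²`, `2t < 2^13` and the Parseval bound leave `t ∈ {128}`; at `t = 128` Parseval + count (`11B + 97C = 1187`), `3n₁ + n₂ = 399099` and the fourth moment `512 n₁ = 17790493 + 23243B + 1806625C` leave no integral solution. [this work] -/
theorem ktg2_no_solution_thirteen (w t A B C n₁ n₂ n₃ P : ℕ) (hw : w = 7 * 2 ^ 13 + t) (ht : 0 < t)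
    (h2 : 2 * t < 2 ^ 13) (hdvd : 2 ^ 13 ∣ t * t) (hABC : A + B + C + 1 = 32 * 2 ^ 13)
    (hP : A * t ^ 2 + B * (2 ^ 13 + t) ^ 2 + C * (3 * 2 ^ 13 + t) ^ 2 + w ^ 2 = 32 * 2 ^ 13 * w)
    (hn : n₁ + n₂ + n₃ + 1 = 32 * 2 ^ 13) (hI : n₁ * (3 * 2 ^ 13 + t) + n₂ * (2 ^ 13 + t) + n₃ * t + w = w ^ 2)
    (h4 : w ^ 4 + A * t ^ 4 + B * (2 ^ 13 + t) ^ 4 + C * (3 * 2 ^ 13 + t) ^ 4 =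
      32 * 2 ^ 13 * (w ^ 2 + n₁ * (3 * 2 ^ 13 + t) ^ 2 + n₂ * (2 ^ 13 + t) ^ 2 + n₃ * t ^ 2))
    (hC : C + 1 = P) : False := by
  have htt := ktg2_t_sq_le 13 w t A B C hw hABC hP
  have hst : 2 ^ 7 ∣ t := by have := ktg_two_pow_dvd_of_sq (a := 13) (by simpa using hdvd); simpa using this
  obtain ⟨q, rfl⟩ : ∃ q, t = 128 * q := ⟨t / 128, by norm_num at hst; omega⟩
  have hq : q < 2 := by
    clear h4 hI hn hP hABC hdvd hC ht h2
    norm_num at htt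
    nlinarith [htt]
  interval_cases q
  · omega
  · subst hw; norm_num at hP hI h4 hABC hn
    have e1 : 11 * B + 97 * C = 1187 := by clear h4 hI hn; omega
    have e2 : 3 * n₁ + n₂ = 399099 := by clear h4 hP hABC; omega
    have key : 512 * n₁ = 17790493 + 23243 * B + 1806625 * C := by linarith
    clear h4 hP hI
    omega

/-- `k = 14` (`m = 19`): `2^14 ∣ t²`, `2t < 2^14` and the Parseval bound leave `t ∈ {128, 256}`; `t = 128` dies by Parseval + count (`65B + 579C = 9161` has no solution); `t = 256` dies by Parseval + count (`33B + 291C = 1513` has no solution). [this work] -/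
theorem ktg2_no_solution_fourteen (w t A B C n₁ n₂ n₃ P : ℕ) (hw : w = 7 * 2 ^ 14 + t) (ht : 0 < t)
    (h2 : 2 * t < 2 ^ 14) (hdvd : 2 ^ 14 ∣ t * t) (hABC : A + B + C + 1 = 32 * 2 ^ 14)
    (hP : A * t ^ 2 + B * (2 ^ 14 + t) ^ 2 + C * (3 * 2 ^ 14 + t) ^ 2 + w ^ 2 = 32 * 2 ^ 14 * w)
    (hI : n₁ * (3 * 2 ^ 14 + t) + n₂ * (2 ^ 14 + t) + n₃ * t + w = w ^ 2)
    (h4 : w ^ 4 + A * t ^ 4 + B * (2 ^ 14 + t) ^ 4 + C * (3 * 2 ^ 14 + t) ^ 4 =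
      32 * 2 ^ 14 * (w ^ 2 + n₁ * (3 * 2 ^ 14 + t) ^ 2 + n₂ * (2 ^ 14 + t) ^ 2 + n₃ * t ^ 2))
    (hC : C + 1 = P) : False := by
  have htt := ktg2_t_sq_le 14 w t A B C hw hABC hP
  have hst : 2 ^ 7 ∣ t := by have := ktg_two_pow_dvd_of_sq (a := 14) (by simpa using hdvd); simpa using this
  obtain ⟨q, rfl⟩ : ∃ q, t = 128 * q := ⟨t / 128, by norm_num at hst; omega⟩
  have hq : q < 3 := by
    clear h4 hI hP hABC hdvd hC ht h2
    norm_num at htt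
    nlinarith [htt]
  interval_cases q
  · omega
  · subst hw; norm_num at hP hABC; clear h4 hI; omega
  · subst hw; norm_num at hP hABC; clear h4 hI; omega

/-- `k = 15` (`m = 20`): `2^15 ∣ t²`, `2t < 2^15` and the Parseval bound leave `t ∈ {256}`; `t = 256` dies by Parseval + count (`65B + 579C = 7113` has no solution). [this work] -/
theorem ktg2_no_solution_fifteen (w t A B C n₁ n₂ n₃ P : ℕ) (hw : w = 7 * 2 ^ 15 + t) (ht : 0 < t)
    (h2 : 2 * t < 2 ^ 15) (hdvd : 2 ^ 15 ∣ t * t) (hABC : A + B + C + 1 = 32 * 2 ^ 15)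
    (hP : A * t ^ 2 + B * (2 ^ 15 + t) ^ 2 + C * (3 * 2 ^ 15 + t) ^ 2 + w ^ 2 = 32 * 2 ^ 15 * w)
    (hI : n₁ * (3 * 2 ^ 15 + t) + n₂ * (2 ^ 15 + t) + n₃ * t + w = w ^ 2)
    (h4 : w ^ 4 + A * t ^ 4 + B * (2 ^ 15 + t) ^ 4 + C * (3 * 2 ^ 15 + t) ^ 4 =
      32 * 2 ^ 15 * (w ^ 2 + n₁ * (3 * 2 ^ 15 + t) ^ 2 + n₂ * (2 ^ 15 + t) ^ 2 + n₃ * t ^ 2))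
    (hC : C + 1 = P) : False := by
  have htt := ktg2_t_sq_le 15 w t A B C hw hABC hP
  have hst : 2 ^ 8 ∣ t := by have := ktg_two_pow_dvd_of_sq (a := 15) (by simpa using hdvd); simpa using this
  obtain ⟨q, rfl⟩ : ∃ q, t = 256 * q := ⟨t / 256, by norm_num at hst; omega⟩
  have hq : q < 2 := by
    clear h4 hI hP hABC hdvd hC ht h2
    norm_num at htt
    nlinarith [htt]
  interval_cases q
  · omega
  · subst hw; norm_num at hP hABC; clear h4 hI; omega

/-- `k = 16` (`m = 21`): `2^16 ∣ t²`, `2t < 2^16` and the Parseval bound leave `t ∈ {256, 512}`; `t = 256` dies by Parseval + count (`129B + 1155C = 18313` has no solution); `t = 512` dies by Parseval + count (`65B + 579C = 3017` has no solution). [this work] -/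
theorem ktg2_no_solution_sixteen_k (w t A B C n₁ n₂ n₃ P : ℕ) (hw : w = 7 * 2 ^ 16 + t) (ht : 0 < t)
    (h2 : 2 * t < 2 ^ 16) (hdvd : 2 ^ 16 ∣ t * t) (hABC : A + B + C + 1 = 32 * 2 ^ 16)
    (hP : A * t ^ 2 + B * (2 ^ 16 + t) ^ 2 + C * (3 * 2 ^ 16 + t) ^ 2 + w ^ 2 = 32 * 2 ^ 16 * w)
    (hI : n₁ * (3 * 2 ^ 16 + t) + n₂ * (2 ^ 16 + t) + n₃ * t + w = w ^ 2)
    (h4 : w ^ 4 + A * t ^ 4 + B * (2 ^ 16 + t) ^ 4 + C * (3 * 2 ^ 16 + t) ^ 4 =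
      32 * 2 ^ 16 * (w ^ 2 + n₁ * (3 * 2 ^ 16 + t) ^ 2 + n₂ * (2 ^ 16 + t) ^ 2 + n₃ * t ^ 2))
    (hC : C + 1 = P) : False := by
  have htt := ktg2_t_sq_le 16 w t A B C hw hABC hP
  have hst : 2 ^ 8 ∣ t := by have := ktg_two_pow_dvd_of_sq (a := 16) (by simpa using hdvd); simpa using this
  obtain ⟨q, rfl⟩ : ∃ q, t = 256 * q := ⟨t / 256, by norm_num at hst; omega⟩
  have hq : q < 3 := by
    clear h4 hI hP hABC hdvd hC ht h2
    norm_num at htt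
    nlinarith [htt]
  interval_cases q
  · omega
  · subst hw; norm_num at hP hABC; clear h4 hI; omega
  · subst hw; norm_num at hP hABC; clear h4 hI; omega
/-! ### The uniform closing for `k ≥ 17` -/

/-- The reduced Parseval identity: `32 t² + B (L + 2t) + 3 C (3L + 2t) = 175 L + 18 t` (`L = 2^k`), from Parseval and the count with
`w = 7L + t`. [this work] -/
theorem ktg2_parseval_reduced (k w t A B C : ℕ) (hw : w = 7 * 2 ^ k + t) (hABC : A + B + C + 1 = 32 * 2 ^ k)
    (hP : A * t ^ 2 + B * (2 ^ k + t) ^ 2 + C * (3 * 2 ^ k + t) ^ 2 + w ^ 2 = 32 * 2 ^ k * w) :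
    32 * (t * t) + B * (2 ^ k + 2 * t) + 3 * C * (3 * 2 ^ k + 2 * t) = 175 * 2 ^ k + 18 * t := by
  have hL : 0 < 2 ^ k := Nat.two_pow_pos k
  apply Nat.eq_of_mul_eq_mul_left hL
  have hPz : (A : ℤ) * t ^ 2 + B * (2 ^ k + t) ^ 2 + C * (3 * 2 ^ k + t) ^ 2 + w ^ 2 = 32 * 2 ^ k * w := by exact_mod_cast hP
  have hABCz : (A : ℤ) + B + C + 1 = 32 * 2 ^ k := by exact_mod_cast hABC
  have hwz : (w : ℤ) = 7 * 2 ^ k + t := by exact_mod_cast hw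
  have e : ((2 ^ k * (32 * (t * t) + B * (2 ^ k + 2 * t) + 3 * C * (3 * 2 ^ k + 2 * t)) : ℕ) : ℤ) =
      ((2 ^ k * (175 * 2 ^ k + 18 * t) : ℕ) : ℤ) := by
    push_cast
    rw [hwz] at hPz
    linear_combination hPz - (t : ℤ) ^ 2 * hABCz
  exact_mod_cast e

/-- The divisibility step: from `(B + 9C)(T + r) + R = M (T + r) + D·C` with `D·C_max < R < T + r` … packaged as: if `X + R = M·(T + r) + S`
with `X` a multiple of `T + r`, `0 < R`, `R < T + r`, `S < T + r` and `R ≠ S`, contradiction. [this work] -/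
theorem ktg2_mod_kill (X Q M R S : ℕ) (hX : ∃ m, X = m * Q) (hE : X + R = M * Q + S) (hR : 0 < R) (hRQ : R < Q) (hSQ : S < Q)
    (hRS : R ≠ S) : False := by
  obtain ⟨m, rfl⟩ := hX
  rcases lt_trichotomy m M with h | h | h
  · have h1 : m * Q + Q ≤ M * Q := by
      have := Nat.mul_le_mul_right Q (Nat.succ_le_of_lt h)
      rw [Nat.succ_mul] at this
      exact this
    omega
  · subst h; omega
  · have h1 : M * Q + Q ≤ m * Q := by
      have := Nat.mul_le_mul_right Q (Nat.succ_le_of_lt h)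
      rw [Nat.succ_mul] at this
      exact this
    omega

/-- **Uniform closing for `k ≥ 17`.**  See the module docstring: only Parseval, the count and `2^k ∣ t²` are used. [this work] -/
theorem ktg2_no_solution_large (k : ℕ) (hk : 17 ≤ k) (w t A B C : ℕ) (hw : w = 7 * 2 ^ k + t) (ht : 0 < t)
    (hdvd : 2 ^ k ∣ t * t) (hABC : A + B + C + 1 = 32 * 2 ^ k)
    (hP : A * t ^ 2 + B * (2 ^ k + t) ^ 2 + C * (3 * 2 ^ k + t) ^ 2 + w ^ 2 = 32 * 2 ^ k * w) : False := by
  have htt := ktg2_t_sq_le k w t A B C hw hABC hP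
  have hP2 := ktg2_parseval_reduced k w t A B C hw hABC hP
  clear hP
  rcases Nat.even_or_odd k with ⟨a, ha⟩ | ⟨a, ha⟩
  · /- `k = 2a`: `L = T²` with `T = 2^a ≥ 512` -/
    have hka : k = 2 * a := by omega
    set T : ℕ := 2 ^ a with hT
    have hL : 2 ^ k = T * T := by rw [hka, two_mul, pow_add]
    have hT512 : 512 ≤ T := by
      have : 9 ≤ a := by omega
      calc (512 : ℕ) = 2 ^ 9 := by norm_num
        _ ≤ 2 ^ a := Nat.pow_le_pow_right (by norm_num) this
    have hTt : T ∣ t := by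
      have := ktg_two_pow_dvd_of_sq (a := k) hdvd
      rw [show (k + 1) / 2 = a by omega] at this
      exact this
    obtain ⟨q, rfl⟩ := hTt
    rw [hL] at htt hP2
    have hT0 : 0 < T := by omega
    have hTT : 0 < T * T := Nat.mul_pos hT0 hT0
    -- `1 ≤ q ≤ 2`
    have hq1 : 1 ≤ q := by
      by_contra h0
      have : q = 0 := by omega
      subst this; simp at ht
    have hq2 : q ≤ 2 := by
      by_contra hq
      have hq3 : 3 ≤ q := by omega
      have hX : T * 3 ≤ T * q := Nat.mul_le_mul_left T hq3
      have h18 : 18 * (T * q) ≤ T * q * (T * q) := Nat.mul_le_mul_right _ (by omega)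
      have h9 : T * 3 * (T * 3) ≤ T * q * (T * q) := Nat.mul_le_mul hX hX
      have e9 : T * 3 * (T * 3) = 9 * (T * T) := by ring
      rw [e9] at h9
      omega
    interval_cases q
    · /- `t = T`: `B(T+2) + 3C(3T+2) = 143T + 18` -/
      have hE : B * (T + 2) + 3 * C * (3 * T + 2) = 143 * T + 18 := by
        apply Nat.eq_of_mul_eq_mul_left hT0
        have e : ((T * (B * (T + 2) + 3 * C * (3 * T + 2)) : ℕ) : ℤ) = ((T * (143 * T + 18) : ℕ) : ℤ) := by
          have hz : ((32 * (T * 1 * (T * 1)) + B * (T * T + 2 * (T * 1)) + 3 * C * (3 * (T * T) + 2 * (T * 1)) : ℕ) : ℤ) =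
              ((175 * (T * T) + 18 * (T * 1) : ℕ) : ℤ) := by rw [hP2]
          push_cast at hz ⊢
          linear_combination hz
        exact_mod_cast e
      have hC : C ≤ 15 := by
        by_contra hC'
        have h := Nat.mul_le_mul_right (3 * T + 2) (show 3 * 16 ≤ 3 * C by omega)
        omega
      have hE' : (B + 9 * C) * (T + 2) + 268 = 143 * (T + 2) + 12 * C := by
        have hEz : ((B * (T + 2) + 3 * C * (3 * T + 2) : ℕ) : ℤ) = ((143 * T + 18 : ℕ) : ℤ) := by rw [hE]
        have e : (((B + 9 * C) * (T + 2) + 268 : ℕ) : ℤ) = ((143 * (T + 2) + 12 * C : ℕ) : ℤ) := by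
          push_cast at hEz ⊢; linear_combination hEz
        exact_mod_cast e
      exact ktg2_mod_kill ((B + 9 * C) * (T + 2)) (T + 2) 143 268 (12 * C) ⟨B + 9 * C, rfl⟩ hE' (by norm_num) (by omega) (by omega)
        (by omega)
    · /- `t = 2T`: `B(T+4) + 3C(3T+4) = 47T + 36` -/
      have hE : B * (T + 4) + 3 * C * (3 * T + 4) = 47 * T + 36 := by
        apply Nat.eq_of_mul_eq_mul_left hT0
        have e : ((T * (B * (T + 4) + 3 * C * (3 * T + 4)) : ℕ) : ℤ) = ((T * (47 * T + 36) : ℕ) : ℤ) := by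
          have hz : ((32 * (T * 2 * (T * 2)) + B * (T * T + 2 * (T * 2)) + 3 * C * (3 * (T * T) + 2 * (T * 2)) : ℕ) : ℤ) =
              ((175 * (T * T) + 18 * (T * 2) : ℕ) : ℤ) := by rw [hP2]
          push_cast at hz ⊢
          linear_combination hz
        exact_mod_cast e
      have hC : C ≤ 5 := by
        by_contra hC'
        have h := Nat.mul_le_mul_right (3 * T + 4) (show 3 * 6 ≤ 3 * C by omega)
        omega
      have hE' : (B + 9 * C) * (T + 4) + 152 = 47 * (T + 4) + 24 * C := by
        have hEz : ((B * (T + 4) + 3 * C * (3 * T + 4) : ℕ) : ℤ) = ((47 * T + 36 : ℕ) : ℤ) := by rw [hE]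
        have e : (((B + 9 * C) * (T + 4) + 152 : ℕ) : ℤ) = ((47 * (T + 4) + 24 * C : ℕ) : ℤ) := by
          push_cast at hEz ⊢; linear_combination hEz
        exact_mod_cast e
      exact ktg2_mod_kill ((B + 9 * C) * (T + 4)) (T + 4) 47 152 (24 * C) ⟨B + 9 * C, rfl⟩ hE' (by norm_num) (by omega) (by omega)
        (by omega)
  · /- `k = 2a + 1`: `2L = T²` with `T = 2^(a+1) ≥ 512` -/
    have hka : k = 2 * a + 1 := by omega
    set T : ℕ := 2 ^ (a + 1) with hT
    have hL : 2 * 2 ^ k = T * T := by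
      rw [hka, ← pow_succ', show 2 * a + 1 + 1 = (a + 1) + (a + 1) by ring, pow_add]
    have hT512 : 512 ≤ T := by
      have : 9 ≤ a + 1 := by omega
      calc (512 : ℕ) = 2 ^ 9 := by norm_num
        _ ≤ 2 ^ (a + 1) := Nat.pow_le_pow_right (by norm_num) this
    have hTt : T ∣ t := by
      have := ktg_two_pow_dvd_of_sq (a := k) hdvd
      rw [show (k + 1) / 2 = a + 1 by omega] at this
      exact this
    obtain ⟨q, rfl⟩ := hTt
    have hT0 : 0 < T := by omega
    have hTT : 0 < T * T := Nat.mul_pos hT0 hT0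
    -- `q = 1` from `64 T² q² ≤ 175 T² + 36 T q`
    have htt2 : 64 * (T * q * (T * q)) ≤ 175 * (T * T) + 36 * (T * q) := by
      have := Nat.mul_le_mul_left 2 htt
      rw [show 2 * (175 * 2 ^ k + 18 * (T * q)) = 175 * (2 * 2 ^ k) + 36 * (T * q) by ring, hL] at this
      omega
    have hq1 : q = 1 := by
      have hq1' : 1 ≤ q := by
        by_contra h0
        have : q = 0 := by omega
        subst this; simp at ht
      by_contra hq
      have hq2 : 2 ≤ q := by omega
      have hX : T * 2 ≤ T * q := Nat.mul_le_mul_left T hq2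
      have h36 : 36 * (T * q) ≤ T * q * (T * q) := Nat.mul_le_mul_right _ (by omega)
      have h4 : T * 2 * (T * 2) ≤ T * q * (T * q) := Nat.mul_le_mul hX hX
      have e4 : T * 2 * (T * 2) = 4 * (T * T) := by ring
      rw [e4] at h4
      omega
    subst hq1
    /- `t = T`, `2L = T²`: `B(T+4) + 3C(3T+4) = 111T + 36` -/
    have hE : B * (T + 4) + 3 * C * (3 * T + 4) = 111 * T + 36 := by
      apply Nat.eq_of_mul_eq_mul_left hT0
      have e : ((T * (B * (T + 4) + 3 * C * (3 * T + 4)) : ℕ) : ℤ) = ((T * (111 * T + 36) : ℕ) : ℤ) := by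
        have hz : ((2 * (32 * (T * 1 * (T * 1)) + B * (2 ^ k + 2 * (T * 1)) + 3 * C * (3 * 2 ^ k + 2 * (T * 1))) : ℕ) : ℤ) =
            ((2 * (175 * 2 ^ k + 18 * (T * 1)) : ℕ) : ℤ) := by rw [hP2]
        have hLz : ((2 * 2 ^ k : ℕ) : ℤ) = ((T * T : ℕ) : ℤ) := by rw [hL]
        push_cast at hz hLz ⊢
        linear_combination hz - ((B : ℤ) + 9 * C - 175) * hLz
      exact_mod_cast e
    have hC : C ≤ 12 := by
      by_contra hC'
      have h := Nat.mul_le_mul_right (3 * T + 4) (show 3 * 13 ≤ 3 * C by omega)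
      omega
    have hE' : (B + 9 * C) * (T + 4) + 408 = 111 * (T + 4) + 24 * C := by
      have hEz : ((B * (T + 4) + 3 * C * (3 * T + 4) : ℕ) : ℤ) = ((111 * T + 36 : ℕ) : ℤ) := by rw [hE]
      have e : (((B + 9 * C) * (T + 4) + 408 : ℕ) : ℤ) = ((111 * (T + 4) + 24 * C : ℕ) : ℤ) := by
        push_cast at hEz ⊢; linear_combination hEz
      exact_mod_cast e
    exact ktg2_mod_kill ((B + 9 * C) * (T + 4)) (T + 4) 111 408 (24 * C) ⟨B + 9 * C, rfl⟩ hE' (by norm_num) (by omega) (by omega)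
      (by omega)

/-- **No solution for any `k`.** [this work] -/
theorem ktg2_no_solution_all (k w t A B C n₁ n₂ n₃ j : ℕ) (hw : w = 7 * 2 ^ k + t) (ht : 0 < t)
    (h2 : 2 * t < 2 ^ k) (hdvd : 2 ^ k ∣ t * t) (hABC : A + B + C + 1 = 32 * 2 ^ k)
    (hP : A * t ^ 2 + B * (2 ^ k + t) ^ 2 + C * (3 * 2 ^ k + t) ^ 2 + w ^ 2 = 32 * 2 ^ k * w)
    (hn : n₁ + n₂ + n₃ + 1 = 32 * 2 ^ k) (hI : n₁ * (3 * 2 ^ k + t) + n₂ * (2 ^ k + t) + n₃ * t + w = w ^ 2)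
    (h4 : w ^ 4 + A * t ^ 4 + B * (2 ^ k + t) ^ 4 + C * (3 * 2 ^ k + t) ^ 4 =
      32 * 2 ^ k * (w ^ 2 + n₁ * (3 * 2 ^ k + t) ^ 2 + n₂ * (2 ^ k + t) ^ 2 + n₃ * t ^ 2))
    (hC : C + 1 = 2 ^ j) : False := by
  rcases Nat.lt_or_ge k 12 with hk11 | hk12
  · exact ktg2_no_solution_le_eleven k (by omega) w t A B C n₁ n₂ n₃ j hw ht h2 hdvd hABC hP hn hI h4 hC
  rcases Nat.lt_or_ge k 17 with hk16 | hk17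
  · obtain ⟨P, hPj⟩ : ∃ P, 2 ^ j = P := ⟨_, rfl⟩
    rw [hPj] at hC
    clear hPj
    obtain ⟨i, hi, rfl⟩ : ∃ i, i ≤ 4 ∧ k = 12 + i := ⟨k - 12, by omega, by omega⟩
    interval_cases i
    · exact ktg2_no_solution_twelve w t A B C n₁ n₂ n₃ P hw ht h2 hdvd hABC hP hI h4 hC
    · exact ktg2_no_solution_thirteen w t A B C n₁ n₂ n₃ P hw ht h2 hdvd hABC hP hn hI h4 hC
    · exact ktg2_no_solution_fourteen w t A B C n₁ n₂ n₃ P hw ht h2 hdvd hABC hP hI h4 hC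
    · exact ktg2_no_solution_fifteen w t A B C n₁ n₂ n₃ P hw ht h2 hdvd hABC hP hI h4 hC
    · exact ktg2_no_solution_sixteen_k w t A B C n₁ n₂ n₃ P hw ht h2 hdvd hABC hP hI h4 hC
  · exact ktg2_no_solution_large k hk17 w t A B C hw ht hdvd hABC hP

/-! ### The second gap for every `m` -/

/-- **The second Kasami–Tokura gap of cubics, every `m`.**  No Boolean function of degree `≤ 3` on `m` bits has `7·2^m < 32·#{c = 1}` and
`64·#{c = 1} < 15·2^m` (weight strictly between `1.75 d` and `1.875 d`, `d = 2^{m-3}`).  Classification-free.  NOT summit progress.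
[this work; cite: KasamiTokura1970 Thm 1, MacWilliamsSloane1977 Ch. 15 §3] -/
theorem kt_gap2_cubic : ∀ (m : ℕ) (c : (Fin m → Bool) → Bool), IsDegLeFun 3 c →
    ¬ (7 * 2 ^ m < 32 * #(univ.filter fun x => c x = true) ∧ 64 * #(univ.filter fun x => c x = true) < 15 * 2 ^ m) := by
  intro m
  induction m with
  | zero => intro c _ h; simp only [pow_zero] at h; omega
  | succ m ihm =>
    intro c hc h
    rcases Nat.lt_or_ge m 4 with hm4 | hm4
    · obtain ⟨h1, h2⟩ := h
      interval_cases m <;> norm_num at h1 h2 <;> omega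
    · obtain ⟨k, rfl⟩ : ∃ k, m = k + 4 := ⟨m - 4, by omega⟩
      have hN : 2 ^ (k + 4 + 1) = 32 * 2 ^ k := by ring
      rw [hN] at h
      have ih' : ∀ c' : (Fin (k + 4) → Bool) → Bool, IsDegLeFun 3 c' →
          ¬ (7 * 2 ^ k < 2 * #(univ.filter fun y => c' y = true) ∧ 4 * #(univ.filter fun y => c' y = true) < 15 * 2 ^ k) := by
        intro c' hc' h'
        have hN4 : 2 ^ (k + 4) = 16 * 2 ^ k := by ring
        refine ihm c' hc' ?_
        rw [hN4]; omega
      obtain ⟨w, t, A, B, C, n₁, n₂, n₃, j, hwS, hwt, hdvd, hABC, hP, hn, hI, h4, hC⟩ :=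
        ktg2_step k ih' c hc (by omega) (by omega)
      exact ktg2_no_solution_all k w t A B C n₁ n₂ n₃ j hwt (by omega) (by omega) hdvd hABC hP hn hI h4 hC

/-- **Cubic weights below `1.875 d`, every `m`**: a Boolean function of degree `≤ 3` on `m` bits with `64·#{c = 1} < 15·2^m` has
`#{c = 1} ∈ {0, 2^{m-3}, 1.5·2^{m-3}, 1.75·2^{m-3}}`.  NOT summit progress. [this work; cite: KasamiTokura1970 Thm 1] -/
theorem rm3_weights_below_fifteen_eighths_all {m : ℕ} (c : (Fin m → Bool) → Bool) (hc : IsDegLeFun 3 c)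
    (h : 64 * #(univ.filter fun x => c x = true) < 15 * 2 ^ m) :
    #(univ.filter fun x => c x = true) = 0 ∨ 8 * #(univ.filter fun x => c x = true) = 2 ^ m ∨
      16 * #(univ.filter fun x => c x = true) = 3 * 2 ^ m ∨ 32 * #(univ.filter fun x => c x = true) = 7 * 2 ^ m := by
  by_cases hlt : 32 * #(univ.filter fun x => c x = true) < 7 * 2 ^ m
  · rcases rm3_weights_below_seven_quarters c hc hlt with h0 | h0 | h0
    · exact Or.inl h0
    · exact Or.inr (Or.inl h0)
    · exact Or.inr (Or.inr (Or.inl h0))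
  · have hg := kt_gap2_cubic m c hc
    right; right; right; omega

end Summit.QuantumAdvantage.QuantumAdvantage.Theorems.CubicForrelation.NearExactIsExact

end
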